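import Summits.BirchSwinnertonDyer.BirchSwinnertonDyer.Theorems.PAdicOrderThesisR2.Negative.AtEveryGoodPrimeFalse

/-!
# `PAdicOrderPadicBSDrankR2` (crux stmt-BirchSwinnertonDyer-0490, routes `PAdicOrderV2` / `PAdicOrder`):
# ordinarity `p ∤ a_p` is load-bearing — weakened to good reduction the rank clause is FALSE as
# typed, modulo the newform of `y² = x³ - x` (negative-side support, refuter crux-disprover seat;
# this file does NOT refute the crux)

The crux asserts `ord_{T=0} L_p(f, unitRoot W p, T) = rank_ℤ W(ℚ)` at every good ORDINARY prime,
for every `f` with `IsNewformOf W f`. The natural strengthening "at every prime of good reduction"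
(replace `IsOrdinaryAt W p` by `W.HasGoodReductionAtPrime p`) is not merely open (supersingular
`p` would need the signed `L_p^±`): in the tree it is FALSE, because off the ordinary locus
`unitRoot W p` is the junk `0` and `L_p(f, 0, T) = 0` — both facts are the sibling seat's theorems
`unitRoot_eq_zero_of_dvd`, `padicLFunction_zero`, `order_ne_natCast_of_dvd`
(`Theorems/PAdicOrderThesisR2/Negative/AtEveryGoodPrimeFalse`, crux stmt-0487), REUSED here, not
re-declared. What this file adds is the `∀ f`-form needed by crux #3, whose hypotheses — unlike the
`∃ f` thesis — are only dischargeable through an actual newform: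

* `pAdicOrderPadicBSDrankR2_false_without_ordinary_of_isNewformOf` — for ANY `f ∈ S₂(Γ₀(N))` with
  `IsNewformOf E₁ f` (`E₁ : y² = x³ - x`, Cremona 32a2, the CM newform of level `32`), the
  good-reduction variant of the crux (stated inline; no proposition is defined under `Summits/`)
  fails at `(E₁, p = 7, f)`: `7` is a good supersingular prime of `E₁` (`a_7 = 0`, Ireland–Rosen
  Ch. 18 Thm 5; `seven_dvd_frobeniusTrace_congruentNumberCurve_one`).
* `pAdicOrderPadicBSDrankR2_false_without_ordinary_of_modularity` — the same modulo the tree's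
  modularity fact `exists_isNewformOf` (Breuil–Conrad–Diamond–Taylor 2001 Thm A; Diamond–Shurman
  Thm 8.8.3), which supplies that `f` at level `N_{E₁}` (`NeZero` by `conductorNorm_pos_holds`).

Moral for planners/provers: do not restate crux #3 over good primes; any proof must use
`¬ p ∣ a_p` (it enters through Hensel, `unitRoot_spec_holds`).
-/

noncomputable section

-- D-0017: single-problem summit, so `Summit.BirchSwinnertonDyer.BirchSwinnertonDyer.…` repeats a
-- namespace BY DESIGN.
set_option linter.dupNamespace false

namespace Summit.BirchSwinnertonDyer.BirchSwinnertonDyer.Theorems.PAdicOrderPadicBSDrankR2.Negative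

open scoped MatrixGroups ModularForm
open CongruenceSubgroup Literature.NumberTheory.EllipticCurves
  Literature.NumberTheory.EllipticCurves.ModularForms
open Summit.BirchSwinnertonDyer.BirchSwinnertonDyer.Theorems.PAdicOrderThesisR2.Negative

/-- **Ordinarity is load-bearing for crux #3, modulo the newform of `E₁`.** For ANY
`f ∈ S₂(Γ₀(N))` with `IsNewformOf E₁ f`, the good-reduction variant of `PAdicOrderPadicBSDrankR2`
(inline) is false: at `(E₁, p = 7, f)` the prime is supersingular, `unitRoot E₁ 7 = 0`, and
`L_7(f, 0, T) = 0` has order `⊤ ≠ rank`. [folklore] -/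
theorem pAdicOrderPadicBSDrankR2_false_without_ordinary_of_isNewformOf {N : ℕ} [NeZero N]
    (f : CuspForm (Gamma0 N) 2) (hf : IsNewformOf (congruentNumberCurve 1) f) :
    ¬ (∀ (W : WeierstrassCurve ℚ) [W.IsElliptic] [W.IsGloballyMinimal] (p : ℕ) [Fact p.Prime],
        W.HasGoodReductionAtPrime p → ∀ {N : ℕ} [NeZero N] (f : CuspForm (Gamma0 N) 2),
          IsNewformOf W f → (padicLFunction f (unitRoot W p : ℚ_[p])).order = W.mordellWeilRank) := by
  intro h
  haveI : (congruentNumberCurve 1).IsElliptic := isElliptic_congruentNumberCurve one_ne_zero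
  haveI : (congruentNumberCurve 1).IsGloballyMinimal :=
    isGloballyMinimal_congruentNumberCurve squarefree_one
  haveI : Fact (Nat.Prime 7) := ⟨by norm_num⟩
  exact order_ne_natCast_of_dvd _ 7 seven_dvd_frobeniusTrace_congruentNumberCurve_one f _
    (h (congruentNumberCurve 1) 7 (hasGoodReductionAtPrime_congruentNumberCurve (by norm_num)) f hf)

/-- **The same, modulo modularity.** Granting the tree's named fact `exists_isNewformOf`
(Breuil–Conrad–Diamond–Taylor; it supplies the newform of `E₁` at level `N_{E₁}`), the
good-reduction variant of crux #3 is false. [folklore] -/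
theorem pAdicOrderPadicBSDrankR2_false_without_ordinary_of_modularity (hmod : exists_isNewformOf) :
    ¬ (∀ (W : WeierstrassCurve ℚ) [W.IsElliptic] [W.IsGloballyMinimal] (p : ℕ) [Fact p.Prime],
        W.HasGoodReductionAtPrime p → ∀ {N : ℕ} [NeZero N] (f : CuspForm (Gamma0 N) 2),
          IsNewformOf W f → (padicLFunction f (unitRoot W p : ℚ_[p])).order = W.mordellWeilRank) := by
  haveI : (congruentNumberCurve 1).IsElliptic := isElliptic_congruentNumberCurve one_ne_zero
  haveI : NeZero ((congruentNumberCurve 1).conductorNorm ℤ) :=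
    ⟨(WeierstrassCurve.conductorNorm_pos_holds (W := congruentNumberCurve 1)).ne'⟩
  obtain ⟨f, hf⟩ := hmod (congruentNumberCurve 1)
  exact pAdicOrderPadicBSDrankR2_false_without_ordinary_of_isNewformOf f hf

end Summit.BirchSwinnertonDyer.BirchSwinnertonDyer.Theorems.PAdicOrderPadicBSDrankR2.Negative

end
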